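import Summits.CriticalPhenomena.PercolationContinuityZ3.Theorems.Transplant.SkelPhiConcReachClauses
import Summits.CriticalPhenomena.PercolationContinuityZ3.Theorems.Transplant.KNCells2ChainCorridorR
import HarnessLib

/-!
# Residue (C) of route D″ v2 AT THE ROOTED CORRIDOR SCHEDULE (finding F-DP4-2; stmt-g9 06:18:11Z/06:40:02Z): the kit-discharged run form
# `Skelφ.reachOblRH_of_stepI` (SkelPhiConcReachClauses) instantiated at the per-axis ROOTED corridor schedules
# `SchOf y du := ChainPlanar.Corr.scheduleR (hC du.1) du.1 (sgOf_sign du) (P.cen y)` (KNCells2ChainCorridorR, band phase by `Band.scheduleRO`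
# over `Band.BandOKR`): as `reachOblRH_of_stepI_corr` but the band's room is split — ALONG `hρ₀ : 3q + s₁ + 2R' ≤ 5 r∥`, ACROSS `hρ₂ : ρ ≤ 2 r⊥` —
# so no axis-ratio condition is asked of the params file (`signChoice₀`, stmt-g9)

builds on p205010 (kernel theorem, internal audit signed; external expert review pending) — nothing in this file uses p205010.
Lane `prim-bschramm`, seat `prim-bschramm-p5` (gen 6; (C) column of the D″ order of battle), helper file (`--supports stmt-CriticalPhenomena-4575 --as helper`).
* **`Skelφ.reachOblRH_of_stepI_corrR`**.
[cite: KozmaNitzan2024, §4 Lemmas 10–12 (pp. 17–25), p. 26 (M_v, H_{v,x}), p. 31]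
-/

noncomputable section

open MeasureTheory

namespace Summit.CriticalPhenomena.PercolationContinuityZ3.Theorems

namespace Transplant

namespace Skelφ

open Literature.Probability.Percolation Literature.Probability.LatticeModels SimpleGraph GadgetSystem ProbeHistory HSiteScheme Contour KNCells
open KNCells.KSchA KNLevels ChainPlanar
open Literature.Probability.Percolation.GM
open Literature.Probability.Percolation.KozmaNitzan.Cells (oth oth_oth sgOf sgOf_sign stepVec_apply_fst stepVec_apply_oth)
open Literature.Barriers.CriticalPhenomena (graphBall graphBall_finite mem_graphBall_self graphBall_mono)
open BoxProdZ2 (ConcRadiiG nQ nS Erad Frad)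
open Skel (excess winGraph winGraphIn winGraphIn_le nmaxC ReachOblAtH ReachOblRH)
open SkelI (tanOff)

open scoped Classical

variable {V : Type} [DecidableEq V] {G : SimpleGraph V} [G.LocallyFinite] {φ : V → Site 2} {types : Finset V}

/-- **RESIDUE (C) FROM THE STEP-I′ CERTIFICATE AT THE ROOTED CORRIDOR SCHEDULES** (coupling-free rooms: `hρ₀` along, `hρ₂` across).
[cite: KozmaNitzan2024, §4 Lemmas 10–12 (pp. 17–25), p. 26, p. 31] -/
theorem reachOblRH_of_stepI_corrR [Countable V] (hlip : Lip G φ) (hstep : Steps G φ) (hfr : Frames G φ types) (hκ : CylConn G φ types)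
    {Δ : ℕ} (hΔ : ∀ v, G.degree v ≤ Δ) {p : unitInterval} (hC : CylSubcritical G φ types p) {D : StepI.Data V} {off : ℕ}
    (hD : D.Λ = fatSeqOff hfr hC off) {Sz Sx Sy : Finset ℕ} (q : unitInterval) {δ : ℝ} (hδ : 0 < δ)
    (h : ∀ i ∈ StepI.index types Sz Sx Sy, 1 - δ ^ 2 < (bondPercolation G q).real (StepI.event G φ D i))
    -- the scheme of record and its radii rooms
    (P : PCells2) (t : V) (gap gap' : ℕ → ℕ) (E₀ L' : ℕ) (δc : ℝ) {R' Rlev N j₀ j₁ : ℕ} (hRl : Rlev + 1 ≤ R') (hj : j₁ ≤ Rlev)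
    (hΛ : WFS2 P (concRadii2S P gap gap' E₀ L')) (hφ : φ t = 0) (hgap : ∀ n, 20 * P.rmax ≤ gap n) (hE₀ : 44 * P.rmax + 3 ≤ E₀)
    (hgapL : ∀ ρ, L' ≤ gap ρ)
    -- the corridor schedules per axis: parameters, admissibility, the nine rooms, the length bound
    {L₁₀ W₁₀ L₂₀ W₂₀ qq q' s₁ ρ : Fin 2 → ℤ} {ℓ₀₁ ℓ₁₁ WM₁ N₁ ℓ₀₂ ℓ₁₂ WM₂ N₂ ℓ₀₃ N₃ WM₃ ℓ₁₃ : Fin 2 → ℕ} {Wb₁ Wb₂ Wb₃ : Fin 2 → ℕ → ℕ}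
    (hOK : ∀ a, Corr.CorrROK (L₁₀ a) (W₁₀ a) (L₂₀ a) (W₂₀ a) (qq a) (q' a) (s₁ a) (ρ a) R' (ℓ₀₁ a) (ℓ₁₁ a) (WM₁ a) (N₁ a) (ℓ₀₂ a) (ℓ₁₂ a)
      (WM₂ a) (N₂ a) (ℓ₀₃ a) (N₃ a) (WM₃ a) (ℓ₁₃ a) (Wb₁ a) (Wb₂ a) (Wb₃ a))
    (hL : ∀ a, L₁₀ a = 3 * (P.r (oth a) : ℤ)) (hW : ∀ a, W₁₀ a = 3 * (P.r a : ℤ))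
    (h₁L : ∀ a, max (L₁₀ a) (ℓ₀₁ a : ℤ) + R' + ℓ₁₁ a ≤ 5 * (P.r (oth a) : ℤ))
    (h₁W : ∀ a, Loc.W (W₁₀ a) R' (WM₁ a) (N₁ a + 1) + R' + WM₁ a ≤ 5 * (P.r a : ℤ))
    (h₂L : ∀ a, max (L₂₀ a) (ℓ₀₂ a : ℤ) + R' + ℓ₁₂ a ≤ 5 * (P.r a : ℤ))
    (h₂W : ∀ a, Loc.W (W₂₀ a) R' (WM₂ a) (N₂ a + 1) + R' + WM₂ a ≤ 5 * (P.r (oth a) : ℤ))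
    (hρ₀ : ∀ a, 3 * qq a + s₁ a + 2 * R' ≤ 5 * (P.r a : ℤ)) (hρ₂ : ∀ a, ρ a ≤ 2 * (P.r (oth a) : ℤ))
    (hfar : ∀ a, qq a + ((N₃ a : ℤ) + 1) * s₁ a ≤ 22 * (P.r a : ℤ)) (h17 : ∀ a, 17 * (P.r a : ℤ) ≤ qq a + ((N₃ a : ℤ) + 1) * s₁ a)
    (hw : ∀ a, Band.w₁ (q' a) R' (WM₃ a) + (N₃ a : ℤ) * R' ≤ 2 * (P.r (oth a) : ℤ))
    (hnC : ∀ a, N₁ a + 1 + N₂ a + 1 + N₃ a ≤ nmaxC)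
    -- the count and the excess
    {η : ℝ} (hcount : 1 / (1 - (q : ℝ)) ^ (Δ * N) ≤ δ * ((Finset.Icc j₀ j₁).card : ℝ)) (hη : η ≤ δ / 2)
    {Rex : ℕ → ℕ}
    (hRex : ∀ R₀' R₁, Rex R₀' ≤ R₁ → ∀ (Rw : ℕ) (D' A' : Finset V), (∀ d ∈ D', d ∈ graphBall G t Rw) →
      (∀ d ∈ D', ∀ d' ∈ D', φ d - φ d' ∈ box 2 (50 * P.rmax)) → A' ⊆ D' → (∀ a ∈ A', a ∈ graphBall G t R₀') →
        (bondPercolation G q).real (excess G t R₁ D' A') ≤ η)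
    (hsch : ∀ g, Rex (Erad gap gap' E₀ g + 1) + L' ≤ Erad gap gap' E₀ (g + 1))
    -- the kit and the slab/shell rooms of `kitClause'`
    {Mz : ℕ} (hMz : Mz ∈ Sz) (hkz : D.k ≤ Mz) {ℓK : Fin 2 → ℕ} (hℓK0 : ∀ I, I = 0 → ℓK I ∈ Sx) (hℓK1 : ∀ I, I = 1 → ℓK I ∈ Sy)
    {A : Fin 2 → Fin 2 → ℕ} {Rk : Fin 2 → ℕ} (hAw : ∀ I, A I = StepI.widths D.Gb D.Fb I (ℓK I)) (hRk : ∀ I, Rk I = D.R (amax (A I)))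
    {ℓs M K R'k r₀ rs : ℕ} (hℓs : 1 ≤ ℓs) (hj₀ : tanOff ℓs M ≤ j₀)
    (hA : ∀ i k, A i k ≤ M) (hAℓ : ∀ i, A i (oth i) ≤ ℓs) (hK : ∀ i, ℓs + 1 + A i i + Rk i ≤ K)
    (hnA : ∀ i, Mz + 1 ≤ A i i) (hnM : Mz ≤ M) (hρK : ∀ i, ℓs + 1 + A i i + (fatRadius hfr hC Mz + off) ≤ K)
    (hR'₁ : cylRadMax G φ types ℓs (ℓs + 2 + 2 * tanOff ℓs M) ≤ R'k) (hR'₂ : ∀ i, cylRadMax G φ types ℓs (ℓs + 2 + A i i + Rk i) ≤ R'k)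
    (hr₀₁ : ℓs + 1 + tanOff ℓs M + R'k ≤ r₀) (hr₀₂ : ℓs + 2 + tanOff ℓs M + K ≤ r₀)
    (hrs₁ : ℓs + 2 + tanOff ℓs M + R'k ≤ rs) (hrs₂ : ℓs + 2 + tanOff ℓs M + K ≤ rs) {cU : ℕ} (hcU : ∀ i, (Δ + 1) ^ Rk i ≤ cU)
    -- the route rooms per axis over the merged extent range `[min ℓ₀ᵢ, max ℓ₁ᵢ]`
    (hMℓ : ∀ a, Mz + 1 ≤ min (min (ℓ₀₁ a) (ℓ₀₂ a)) (ℓ₀₃ a))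
    (hSx : ∀ a ℓ, min (min (ℓ₀₁ a) (ℓ₀₂ a)) (ℓ₀₃ a) ≤ ℓ → ℓ ≤ max (max (ℓ₁₁ a) (ℓ₁₂ a)) (ℓ₁₃ a) → ℓ ∈ Sx)
    (hSy : ∀ a ℓ, min (min (ℓ₀₁ a) (ℓ₀₂ a)) (ℓ₀₃ a) ≤ ℓ → ℓ ≤ max (max (ℓ₁₁ a) (ℓ₁₂ a)) (ℓ₁₃ a) → ℓ ∈ Sy)
    (hdepth : ∀ a a' I ℓ, min (min (ℓ₀₁ a) (ℓ₀₂ a)) (ℓ₀₃ a) ≤ ℓ → ℓ ≤ max (max (ℓ₁₁ a) (ℓ₁₂ a)) (ℓ₁₃ a) →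
      2 * ℓs + 2 + tanOff ℓs M + A I I + D.R (amax (StepI.widths D.Gb D.Fb a' ℓ)) ≤ r₀)
    (hWr₁ : ∀ a ℓ, min (min (ℓ₀₁ a) (ℓ₀₂ a)) (ℓ₀₃ a) ≤ ℓ → ℓ ≤ max (max (ℓ₁₁ a) (ℓ₁₂ a)) (ℓ₁₃ a) →
      StepI.widths D.Gb D.Fb (oth a) ℓ (oth (oth a)) ≤ Wb₁ a ℓ)
    (hWr₂ : ∀ a ℓ, min (min (ℓ₀₁ a) (ℓ₀₂ a)) (ℓ₀₃ a) ≤ ℓ → ℓ ≤ max (max (ℓ₁₁ a) (ℓ₁₂ a)) (ℓ₁₃ a) →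
      StepI.widths D.Gb D.Fb a ℓ (oth a) ≤ Wb₂ a ℓ)
    (hWr₃ : ∀ a ℓ, min (min (ℓ₀₁ a) (ℓ₀₂ a)) (ℓ₀₃ a) ≤ ℓ → ℓ ≤ max (max (ℓ₁₁ a) (ℓ₁₂ a)) (ℓ₁₃ a) →
      StepI.widths D.Gb D.Fb a ℓ (oth a) ≤ Wb₃ a ℓ)
    -- the depth budget and the kit number
    (hr₀L : r₀ + 3 ≤ L') (hL'E : L' ≤ E₀) (kk : ℕ) (hN : kk * (Δ + 1) ^ (2 * rs) ≤ N)
    (hkk : (1 - (q : ℝ) ^ (1 + Δ * ((Δ + 1) ^ R'k + (tanOff ℓs M + 2)) + ((Δ + 1) ^ R'k + (tanOff ℓs M + 2)) * cU)) ^ kk ≤ δ) :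
    ReachOblRH G (⟨cellGeomSG G φ P t (concRadii2S P gap gap' E₀ L'), q, δc⟩ : KSchA V ℕ)
      (faceDataSG G φ P t (concRadii2S P gap gap' E₀ L')) Δ δ := by
  -- the corridor schedule of the probe `(y, du)`
  let SchOf : Site 2 → MDir → Schedule := fun y du => Corr.scheduleR (hOK du.1) du.1 (sgOf_sign du) (P.cen y)
  have hpar : ∀ y du, (SchOf y du).N = N₁ du.1 + 1 + N₂ du.1 + 1 + N₃ du.1 ∧ (SchOf y du).R' = R' ∧
      (SchOf y du).ℓ₀ = min (min (ℓ₀₁ du.1) (ℓ₀₂ du.1)) (ℓ₀₃ du.1) ∧ (SchOf y du).ℓ₁ = max (max (ℓ₁₁ du.1) (ℓ₁₂ du.1)) (ℓ₁₃ du.1) :=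
    fun y du => Corr.scheduleR_params (hOK du.1) du.1 (sgOf_sign du) (P.cen y)
  -- the axis and the spread of every step, by phase
  have hphase : ∀ y du k, ((SchOf y du).ax k = oth du.1 ∧ (SchOf y du).Wb k = Wb₁ du.1) ∨
      ((SchOf y du).ax k = du.1 ∧ (SchOf y du).Wb k = Wb₂ du.1) ∨ ((SchOf y du).ax k = du.1 ∧ (SchOf y du).Wb k = Wb₃ du.1) := by
    intro y du k
    by_cases hk1 : k ≤ N₁ du.1
    · obtain ⟨h1, h2, -, -⟩ := Corr.scheduleR_step₁ (hOK du.1) du.1 (sgOf_sign du) (P.cen y) hk1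
      exact Or.inl ⟨h1, h2⟩
    · by_cases hk2 : k ≤ N₁ du.1 + 1 + N₂ du.1
      · obtain ⟨j, rfl⟩ : ∃ j, k = N₁ du.1 + 1 + j := ⟨k - (N₁ du.1 + 1), by omega⟩
        obtain ⟨h1, h2, -, -⟩ := Corr.scheduleR_step₂ (hOK du.1) du.1 (sgOf_sign du) (P.cen y) (j := j) (by omega)
        exact Or.inr (Or.inl ⟨h1, h2⟩)
      · obtain ⟨j, rfl⟩ : ∃ j, k = N₁ du.1 + 1 + N₂ du.1 + 1 + j := ⟨k - (N₁ du.1 + 1 + N₂ du.1 + 1), by omega⟩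
        obtain ⟨h1, h2, -, -⟩ := Corr.scheduleR_step₃ (hOK du.1) du.1 (sgOf_sign du) (P.cen y) j
        exact Or.inr (Or.inr ⟨h1, h2⟩)
  refine reachOblRH_of_stepI hlip hstep hfr hκ hΔ hC hD q hδ h P t gap gap' E₀ L' δc hRl hj hΛ hφ hgap hE₀ hgapL SchOf
    (fun y du => ?_) (fun y du k hk => ?_) (fun y du => ?_) (fun y du => ?_) (fun y du => (hpar y du).2.1) hcount hη hRex hsch hMz hkz hℓK0
    hℓK1 hAw hRk hℓs hj₀ hA hAℓ hK hnA hnM hρK hR'₁ hR'₂ hr₀₁ hr₀₂ hrs₁ hrs₂ hcU (fun y du => ?_) (fun y du k hax ℓ h1 h2 => ?_)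
    (fun y du k hax ℓ h1 h2 => ?_) (fun y du k I ℓ h1 h2 => ?_) (fun y du k ℓ h1 h2 => ?_) hr₀L hL'E kk hN hkk
  · -- the first core is `M_y`
    rw [Corr.scheduleR_core_zero_eq_M (hOK du.1) P y du (hL _) (hW _)]
  · -- the regions lie in `Q_y ∪ H_{y,du}`
    exact Corr.scheduleR_region_subset (hOK du.1) P y du (h₁L _) (h₁W _) (h₂L _) (h₂W _) (hρ₀ _) (hρ₂ _) (hfar _) hk
  · -- the last core lies in `M_{y+du} ∩ H_{y,du}`
    exact Corr.scheduleR_core_last_subset (hOK du.1) P y du (h17 _) (hfar _) (hw _)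
  · -- the length
    rw [(hpar y du).1]; exact hnC du.1
  · -- extents beyond the zone scale
    rw [(hpar y du).2.2.1]; exact hMℓ du.1
  · rw [(hpar y du).2.2.1] at h1; rw [(hpar y du).2.2.2] at h2; exact hSx du.1 ℓ h1 h2
  · rw [(hpar y du).2.2.1] at h1; rw [(hpar y du).2.2.2] at h2; exact hSy du.1 ℓ h1 h2
  · rw [(hpar y du).2.2.1] at h1; rw [(hpar y du).2.2.2] at h2; exact hdepth du.1 _ I ℓ h1 h2
  · rw [(hpar y du).2.2.1] at h1; rw [(hpar y du).2.2.2] at h2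
    rcases hphase y du k with ⟨ha, hb⟩ | ⟨ha, hb⟩ | ⟨ha, hb⟩ <;> rw [ha, hb]
    · exact hWr₁ du.1 ℓ h1 h2
    · exact hWr₂ du.1 ℓ h1 h2
    · exact hWr₃ du.1 ℓ h1 h2

end Skelφ

end Transplant

end Summit.CriticalPhenomena.PercolationContinuityZ3.Theorems

end
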